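import Summits.MatrixMultiplication.OmegaCensus.SmallFormats.MatMul22nPointPairing
import HarnessLib

/-!
# ω-census family (a): the CHEAP ZEROS of the INV-layer matrix `Q` (any field)

Cell `pub-omega` (unit `pub-omega-tensor`, gen 40), topic `Summits/MatrixMultiplication/OmegaCensus` (sub-folder
`SmallFormats`). Framing (verbatim): lottery ticket; floor = certified bounds/negative ranges. HONEST FRAMING: M1-LEAN-BLUEPRINT F6 (entry lemmas, zero part; memo
DEFLATION-g40 §11): with `Q s t = ∑_{p,q} Y q p (W_s row p ⬝ᵥ G_t row q)` (`PointPairing`), the entry vanishes whenever every row of `G_t` is a multiple of a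
vector `c⋆` orthogonal to a plane containing the rows of `W_s` (`PairingZeros.Q_eq_zero_of_G_line`) — e.g. a C-cell `t` against a term `s` of a column in the
pair of `t`'s row, or an (R-cell `s`, C-cell `t`) pair in the obstruction normal form — and dually when every row of `W_s` is a multiple of a covector `n⋆`
orthogonal to a plane containing the rows of `G_t` (`Q_eq_zero_of_W_line`). Nothing here is a bound on `ω`.
-/

namespace Summit.MatrixMultiplication.OmegaCensus.SmallFormats

open Finset Matrix

namespace PairingZeros

variable {k : Type*} [Field k] {n : ℕ}

/-- All row pairings vanish when `G`'s rows lie on a line orthogonal to a plane containing `W`'s rows. -/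
theorem rowPairing_eq_zero_of_G_line (G W : Matrix (Fin 2) (Fin n) k) (cstar : Fin n → k) (η : Fin 2 → k) (hG : ∀ q, G q = η q • cstar)
    (b : Fin 2 → (Fin n → k)) (hW : ∀ p, ∃ a : Fin 2 → k, W p = ∑ m, a m • b m) (hperp : ∀ m, cstar ⬝ᵥ b m = 0) (p q : Fin 2) :
    W p ⬝ᵥ G q = 0 := by
  obtain ⟨a, ha⟩ := hW p
  rw [ha, hG q, dotProduct_smul, sum_dotProduct]
  have : ∀ m, (a m • b m) ⬝ᵥ cstar = 0 := fun m => by rw [smul_dotProduct, dotProduct_comm, hperp m, smul_zero]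
  simp [this]

/-- **Cheap zero, G-side.** -/
theorem Q_eq_zero_of_G_line (Y : Matrix (Fin 2) (Fin 2) k) (G W : Matrix (Fin 2) (Fin n) k) (cstar : Fin n → k) (η : Fin 2 → k)
    (hG : ∀ q, G q = η q • cstar) (b : Fin 2 → (Fin n → k)) (hW : ∀ p, ∃ a : Fin 2 → k, W p = ∑ m, a m • b m) (hperp : ∀ m, cstar ⬝ᵥ b m = 0) :
    (∑ p, ∑ q, Y q p * (W p ⬝ᵥ G q)) = 0 := by
  refine Finset.sum_eq_zero fun p _ => Finset.sum_eq_zero fun q _ => ?_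
  rw [rowPairing_eq_zero_of_G_line G W cstar η hG b hW hperp p q, mul_zero]

/-- All row pairings vanish when `W`'s rows lie on a line orthogonal to a plane containing `G`'s rows. -/
theorem rowPairing_eq_zero_of_W_line (G W : Matrix (Fin 2) (Fin n) k) (nstar : Fin n → k) (ω : Fin 2 → k) (hW : ∀ p, W p = ω p • nstar)
    (c : Fin 2 → (Fin n → k)) (hG : ∀ q, ∃ a : Fin 2 → k, G q = ∑ m, a m • c m) (hperp : ∀ m, nstar ⬝ᵥ c m = 0) (p q : Fin 2) :
    W p ⬝ᵥ G q = 0 := by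
  obtain ⟨a, ha⟩ := hG q
  rw [ha, hW p, smul_dotProduct, dotProduct_sum]
  have : ∀ m, nstar ⬝ᵥ (a m • c m) = 0 := fun m => by rw [dotProduct_smul, hperp m, smul_zero]
  simp [this]

/-- **Cheap zero, W-side.** -/
theorem Q_eq_zero_of_W_line (Y : Matrix (Fin 2) (Fin 2) k) (G W : Matrix (Fin 2) (Fin n) k) (nstar : Fin n → k) (ω : Fin 2 → k)
    (hW : ∀ p, W p = ω p • nstar) (c : Fin 2 → (Fin n → k)) (hG : ∀ q, ∃ a : Fin 2 → k, G q = ∑ m, a m • c m) (hperp : ∀ m, nstar ⬝ᵥ c m = 0) :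
    (∑ p, ∑ q, Y q p * (W p ⬝ᵥ G q)) = 0 := by
  refine Finset.sum_eq_zero fun p _ => Finset.sum_eq_zero fun q _ => ?_
  rw [rowPairing_eq_zero_of_W_line G W nstar ω hW c hG hperp p q, mul_zero]

/-- **The (R-cell, C-cell) zero of the obstruction normal form.** If `W`'s rows are multiples of `n⋆`, `G`'s rows multiples of `c⋆`, and `n⋆ ⬝ᵥ c⋆ = 0`
(non-admissibility), the entry vanishes. -/
theorem Q_eq_zero_of_both_lines (Y : Matrix (Fin 2) (Fin 2) k) (G W : Matrix (Fin 2) (Fin n) k) (cstar nstar : Fin n → k) (η ω : Fin 2 → k)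
    (hG : ∀ q, G q = η q • cstar) (hW : ∀ p, W p = ω p • nstar) (hperp : nstar ⬝ᵥ cstar = 0) :
    (∑ p, ∑ q, Y q p * (W p ⬝ᵥ G q)) = 0 := by
  refine Finset.sum_eq_zero fun p _ => Finset.sum_eq_zero fun q _ => ?_
  rw [hW p, hG q, smul_dotProduct, dotProduct_smul, hperp, smul_zero, smul_zero, mul_zero]

end PairingZeros

end Summit.MatrixMultiplication.OmegaCensus.SmallFormats
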